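import Summits.BirchSwinnertonDyer.Rank1Residual.Additive.GordDescentModelFree
import Literature.NumberTheory.EllipticCurves.NonvanishingTwistsHoffsteinLuo
import Literature.NumberTheory.EllipticCurves.CyclotomicIwasawaMainTheoremIrreducibleBaseChangeProofs
import HarnessLib

/-!
# X4♯(G-ord), defect 2: the descent field is FREE among quadratic fields ramified at `p` — twist supply removes the twist-rank datum

HONEST FRAMING (cell `b2b-bsdres`, run/shared/lean/b2b/bsd-rank1-residual/, verbatim in every
file): the goal of the cell is to DELETE the COMBINATION-SHAPED residual classes of the
Birch–Swinnerton-Dyer formula for ALL analytic-rank `≤ 1` elliptic curves over `ℚ` — "full BSD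
formula for every rank `≤ 1` curve in class `C`" assembled STRICTLY from published theorems — so
that the rank-`≤ 1` remainder becomes exactly the CONSTRUCTION-SHAPED classes, which are TYPED
(missing-input `Prop`s), NOT attempted. This is not "finishing BSD". Sub-cell `additive-p2`
(CLASS-OWNERS row "X3/X4 additive — pot. good ordinary / X3♯(G-ord)"), generation 6: research
route; no claim beyond the stated classes; theorems only, no definition, no new named fact;
X3♯(G-ord)/X4♯(G-ord) stay CONSTRUCTION-SHAPED.

WHAT THIS FILE DOES. Gen 4's class theorem `bsdp_of_classX4Gord_two_of_surj` relocates `BSD(E,p)`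
for `(E,p) ∈ X4♯(G-ord) ∩ I₀*` (`p ≥ 5`, `ρ̄_{E,p}` onto, `r_an(E) ≤ 1`) onto the over-`K` input over
the quadratic fields `K` with `d_K = p*`, under ONE residual datum on the twist: `r_an(E^{(p*)}) ≤ 1`
(census, `census/TWIST-CENSUS.md`: it HOLDS on all 380 X4 `I₀*` pairs at N < 2·10⁴ — the one
defect-2 pair whose twist `E^{(p*)}` has analytic rank `2` is the X3 pair 16758y1 at `p = 3`,
twist 1862a1 — so its removal here is a theorem-level, not a census-level, gain). Here the
descent field is made FREE — any `K = ℚ(√(p*·d'))`, `p ∤ d'` — and the TWIST SUPPLY of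
Hoffstein–Luo 1997 (named fact `HoffsteinLuo1997_exists_twist_L_one_ne_zero`, PUBLISHED, the same
input as additive-p1's `TwistSupply*.lean` for the potentially multiplicative classes) chooses `d'`
with `L(E^{(p*·d')}, 1) ≠ 0`:

* `exists_goodOrd_rankZero_twist_of_typeGOrd` — for a (G)-ordinary defect-2 pair (`p ≥ 5`) there
  are a square-free `d' ≡ 1 (mod 8)` with `p ∤ d'` and a globally minimal `Wd ≅ E^{(p*·d')}` that is
  GOOD ORDINARY at `p` with `r_an(Wd) = 0` (gen 4's good ordinary `E^{(p*)}`; Hoffstein–Luo with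
  `S = {p}`; a unit twist keeps good ordinary reduction, tree `isOrdinaryAt_of_smul_eq_quadraticTwist`,
  Knapp Prop. 12.10);
* `exists_quadraticField_discr_pStar_mul` — `ℚ(√(p*·d'))` exists with `d_K = p*·d'` (fundamental
  discriminant; tree `Quadratic.exists_numberField_discr_eq`);
* `rowC2_twist_of_classX4_of_surj` — any good ordinary twist of an X4 pair with `ρ̄` onto is row C2
  at `p ≥ 5` (gen 4's lemma for general `d`);
* **`bsdp_of_classX4Gord_two_of_surj_of_forall_ramified`** — `(E,p) ∈ X4♯(G-ord)`, `e_E(p) = 2`,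
  `p ≥ 5`, `Surj W p`, `r_an(E) ≤ 1`: **`BSD(E,p)` follows from `MissingPPartOverCAt (W.baseChange K) p`
  granted for every quadratic `K` with `p ∣ d_K`** (+ the published binders GZK, modularity, Milne
  1972 any-model, BCS 2025 Cor. 1.3.1, Hoffstein–Luo 1997) — NO datum on any twist;
  `…_of_forall_quadratic` (plainer hypothesis: over every quadratic field),
  `missingPPartAt_of_classX4Gord_two_of_surj_of_forall_ramified` (Partition currency);
* `bsdp_iff_overC_of_classX4_of_surj_of_goodOrd_twist`, `ClassX4Gord.exists_quadraticField_bsdp_iff`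
  — exactness survives: for every such pair there IS a quadratic `K` ramified at `p` with
  `BSD(E,p) ⟺ MissingPPartOverCAt (W.baseChange K) p`.

So X4♯(G-ord) ∩ I₀* ∩ {`ρ̄` onto} (census: the 226 ‖ 47 C2-twist pairs at `p ≥ 5`, N < 2·10⁴ ‖ 10⁴) now has
the SAME final shape as additive-p1's X3♯(M) / X4(M) ∩ (ram) (`bsdp_of_classX3M_of_forall_ramified`,
`bsdp_of_classX4M_of_ram_of_forall_ramified`): "`BSD(E,p)` ⇐ the `p`-part of BSD for `E` over
every quadratic field ramified at `p`". The over-`K` datum differs — here `E_K` is GOOD ORDINARY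
at the ramified prime (sibling `GordDescentField.lean`), there MULTIPLICATIVE — and in both cases
no published theorem reaches it (Wan 2015 §1.1 / BCS 2025 §2.1: `p` unramified; BDP / JSW: `p`
split; W. Zhang 2014: `p ∤ D_K N`). Labels, census, located gap UNCHANGED
(HOME/b2b-bsdres-additive-p2/AUDIT-X34-GORD.md).

References: J. Hoffstein, W. Luo, *Nonvanishing of L-series and the combinatorial sieve*, Math.
Res. Lett. 4 (1997) 435–442, Theorem; A. Burungale, F. Castella, C. Skinner, IMRN 2025, Cor.
1.3.1; J. S. Milne, Invent. Math. 17 (1972); A. W. Knapp, *Elliptic Curves*, Prop. 12.10;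
J.-P. Serre, Invent. Math. 15 (1972) §4.5; D. Delbourgo, Compositio Math. 113 (1998) §1.5.
-/

noncomputable section

open scoped Classical NumberField

open WeierstrassCurve IsDedekindDomain NumberField Literature.NumberTheory.EllipticCurves
  Literature.NumberTheory.EllipticCurves.Rank1Residual
  Literature.NumberTheory.EllipticCurves.Rank1Residual.Typed
  Summit.BirchSwinnertonDyer.Rank1Residual.AdditivePotMult

namespace Summit.BirchSwinnertonDyer.Rank1Residual.Additive

variable (W : WeierstrassCurve ℚ) [W.IsElliptic] [W.IsGloballyMinimal] (p : ℕ) [hp : Fact p.Prime]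

/-! ### Arithmetic of the discriminant `p* · d'` -/

section Arithmetic

omit hp in
/-- `(d'/p) = 1` forces `p ∤ d'` (`(0/p) = 0`). -/
private theorem not_dvd_of_jacobiSym_eq_one {d' : ℤ} (hp1 : 1 < p) (h : jacobiSym d' p = 1) :
    ¬ (p : ℤ) ∣ d' := by
  intro hdvd
  rw [jacobiSym.mod_left, Int.emod_eq_zero_of_dvd hdvd, jacobiSym.zero_left hp1] at h
  exact zero_ne_one h

/-- `p* · d' ≡ 1 (mod 4)` for `p` odd and `d' ≡ 1 (mod 8)`. -/
theorem pStar_mul_emod_four (hp2 : p ≠ 2) {d' : ℤ} (hd8 : d' % 8 = 1) :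
    ((-1 : ℤ) ^ (p / 2) * p * d') % 4 = 1 := by
  have h1 := pStar_int_emod_four p hp2
  have hd4 : d' % 4 = 1 := by omega
  rw [Int.mul_emod, h1, hd4]
  norm_num

/-- `p* · d'` is square-free for `d'` square-free with `p ∤ d'`. -/
theorem squarefree_pStar_mul {d' : ℤ} (hsq : Squarefree d') (hpd : ¬ (p : ℤ) ∣ d') :
    Squarefree ((-1 : ℤ) ^ (p / 2) * p * d') := by
  rw [← Int.squarefree_natAbs, Int.natAbs_mul, Int.natAbs_mul, Int.natAbs_pow, Int.natAbs_neg,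
    Int.natAbs_one, one_pow, one_mul, Int.natAbs_natCast, Nat.squarefree_mul_iff]
  refine ⟨?_, hp.out.squarefree, Int.squarefree_natAbs.mpr hsq⟩
  exact (Nat.Prime.coprime_iff_not_dvd hp.out).mpr (fun h => hpd (Int.natCast_dvd.mpr h))

/-- `p* · d' ≠ 1` (its absolute value is a multiple of `p ≥ 2`) for `d' ≠ 0`. -/
theorem pStar_mul_ne_one {d' : ℤ} (hd0 : d' ≠ 0) : (-1 : ℤ) ^ (p / 2) * p * d' ≠ 1 := by
  intro h
  have h1 := congrArg Int.natAbs h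
  rw [Int.natAbs_mul, Int.natAbs_mul, Int.natAbs_pow, Int.natAbs_neg, Int.natAbs_one, one_pow,
    one_mul, Int.natAbs_natCast] at h1
  have hd1 : 1 ≤ d'.natAbs := Int.natAbs_pos.mpr hd0
  have hp2 : 2 ≤ p := hp.out.two_le
  nlinarith

/-- **The quadratic field `ℚ(√(p*·d'))` exists** as a number field with `d_K = p*·d'`, for `p` odd,
`d'` square-free, `d' ≡ 1 (mod 8)`, `p ∤ d'` (tree `Quadratic.exists_numberField_discr_eq`: every
fundamental discriminant is a field discriminant). -/
theorem exists_quadraticField_discr_pStar_mul (hp2 : p ≠ 2) {d' : ℤ} (hsq : Squarefree d')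
    (hd8 : d' % 8 = 1) (hpd : ¬ (p : ℤ) ∣ d') :
    ∃ (K : Type) (_ : Field K) (_ : NumberField K), Module.finrank ℚ K = 2 ∧
      NumberField.discr K = (-1 : ℤ) ^ (p / 2) * p * d' :=
  Literature.NumberTheory.QuadraticFields.Quadratic.exists_numberField_discr_eq
    (Or.inl ⟨pStar_mul_emod_four p hp2 hd8, squarefree_pStar_mul p hsq hpd,
      pStar_mul_ne_one p hsq.ne_zero⟩)

end Arithmetic

/-! ### Twist supply: a good ORDINARY twist of analytic rank ZERO, ramified at `p` -/

section Supply

/-- **Every (G)-ordinary defect-2 pair has a GOOD ORDINARY quadratic twist of ANALYTIC RANK ZERO by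
a discriminant divisible by `p`** (`p ≥ 5`, `W` globally minimal; Hoffstein–Luo 1997 `hHL`). Take
the good ordinary twist `E₁ = E^{(p*)}` of gen 4 (`exists_goodOrd_twist_pStar_of_typeGOrd`);
Hoffstein–Luo with `S = {p}` gives a square-free `d' ≡ 1 (mod 8)` with `(d'/p) = 1` — so `p ∤ d'` —
and `L(E₁^{(d')}, 1) ≠ 0`; a globally minimal model `Wd` of `E₁^{(d')} ≅ E^{(p*·d')}` is good
ORDINARY at `p` (`p ∤ 2d'`: tree `isOrdinaryAt_of_smul_eq_quadraticTwist`, Knapp Prop. 12.10) and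
has analytic rank `0`. [cite: HoffsteinLuo1997, Theorem (§1, pp. 435–436)]
[cite: Knapp1993, Prop. 12.10] -/
theorem exists_goodOrd_rankZero_twist_of_typeGOrd
    (hHL : HoffsteinLuo1997_exists_twist_L_one_ne_zero)
    (hp5 : 5 ≤ p) (hG : TypeGOrd W p) (he : semistabilityIndex W p = 2) :
    ∃ (d' : ℤ) (Wd : WeierstrassCurve ℚ) (_ : Wd.IsElliptic) (_ : Wd.IsGloballyMinimal),
      Squarefree d' ∧ d' % 8 = 1 ∧ ¬ (p : ℤ) ∣ d' ∧
      (∃ C : VariableChange ℚ, C • W.quadraticTwist ((-1 : ℚ) ^ (p / 2) * p * d') = Wd) ∧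
      GoodOrd Wd p ∧ Wd.analyticRank = 0 := by
  have hp2 : p ≠ 2 := by omega
  obtain ⟨W₁, iW₁, iW₁m, C₁, hC₁, hord₁⟩ := exists_goodOrd_twist_pStar_of_typeGOrd W p hp5 hG he
  obtain ⟨d', hsq, hd8, -, hjac, hL⟩ := hHL.exists W₁ {p}
  have hj1 : jacobiSym d' p = 1 := hjac p (Finset.mem_singleton_self p) hp.out hp2
  have hpd : ¬ (p : ℤ) ∣ d' := not_dvd_of_jacobiSym_eq_one p hp.out.one_lt hj1
  have hd0 : ((d' : ℤ) : ℚ) ≠ 0 := by exact_mod_cast hsq.ne_zero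
  obtain ⟨Wd, iWd, iWdm, C₂, hC₂⟩ := exists_isGloballyMinimal_smul_eq_quadraticTwist W₁ hd0
  have hordd : IsOrdinaryAt Wd p :=
    isOrdinaryAt_of_smul_eq_quadraticTwist W₁ Wd hsq hC₂ p hp2 hpd ⟨hord₁.1, hord₁.2⟩
  have hWd : Wd = C₂⁻¹ • W₁.quadraticTwist (d' : ℚ) := by rw [← hC₂, inv_smul_smul]
  haveI := W₁.isElliptic_quadraticTwist hd0
  refine ⟨d', Wd, iWd, iWdm, hsq, hd8, hpd, ?_, ⟨hordd.1, hordd.2⟩, ?_⟩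
  · refine ⟨C₂⁻¹ * ⟨C₁.u, (d' : ℚ) * C₁.r, 0, 0⟩, ?_⟩
    rw [hWd, ← hC₁, quadraticTwist_smul, quadraticTwist_quadraticTwist, mul_smul]
  · rw [hWd, analyticRank_smul]
    exact Literature.NumberTheory.EllipticCurves.analyticRank_eq_zero_of_entireLFunction_one_ne_zero
      _ hL

end Supply

/-! ### Row C2 for a general twist and the class theorems with a FREE descent field -/

section X4

variable (Wd : WeierstrassCurve ℚ) [Wd.IsElliptic] [Wd.IsGloballyMinimal]

omit [W.IsGloballyMinimal] in
/-- **Row C2 for ANY good ordinary twist of an X4 pair with `ρ̄_{E,p}` onto** (`p ≥ 5`, `d ≠ 0`):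
surjectivity and irreducibility transport along the twist (`surj_iff_of_model_twist`,
`irr_iff_of_model_twist`), (im) from surjectivity (`X9.bigIm_of_surj`), non-CM at a good ordinary
`p ≥ 5` with surjective `ρ̄` (Serre 1972 §4.5, `not_hasCM_of_hasSurjectiveModNGaloisRep_of_five_le`).
Gen 4's `rowC2_twist_pStar_of_classX4_of_surj` is the case `d = p*`. [cite: Serre1972, §4.5] -/
theorem rowC2_twist_of_classX4_of_surj (hp5 : 5 ≤ p) (hX : ClassX4 W p) (hsurj : Surj W p)
    {d : ℚ} (hd : d ≠ 0) (hWd : ∃ C : VariableChange ℚ, C • W.quadraticTwist d = Wd)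
    (hord : GoodOrd Wd p) : RowC2 Wd p := by
  have hsurjd : Surj Wd p := (surj_iff_of_model_twist W p hd hWd).mpr hsurj
  exact ⟨not_hasCM_of_hasSurjectiveModNGaloisRep_of_five_le Wd p hp5 hord.1 hord.2 hsurjd, by omega,
    hord, (irr_iff_of_model_twist hd hWd).mpr hX.2.2, X9.bigIm_of_surj Wd p hp5 hsurjd⟩

/-- **X4♯(G-ord) ∩ `I₀*`, `p ≥ 5`, `ρ̄_{E,p}` onto, `r_an(E) ≤ 1`: `BSD(E,p)` from the over-`K` input
over the quadratic fields RAMIFIED at `p` — with NO datum on a twist.** If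
`MissingPPartOverCAt (W.baseChange K) p` (the `p`-part of BSD for `E_K`, additive-p1's typed
predicate) is granted for every quadratic field `K` with `p ∣ d_K`, then `BSD(E,p)`. Compared with
gen 4's `bsdp_of_classX4Gord_two_of_surj` the hypothesis `r_an(E^{(p*)}) ≤ 1` is GONE: by the twist
supply (`exists_goodOrd_rankZero_twist_of_typeGOrd`, Hoffstein–Luo `hHL`) some twist `E^{(p*·d')}`,
`p ∤ d'`, is good ordinary at `p` of analytic rank `0`, hence row C2 (`rowC2_twist_of_classX4_of_surj`;
`BSD` by Burungale–Castella–Skinner 2025 Cor. 1.3.1 `hBCS`), and the descent runs over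
`K = ℚ(√(p*·d'))` (`exists_quadraticField_discr_pStar_mul`; Milne 1972 any-model `hMilneC`, GZK
`hGZK`, modularity `hmod`: additive-p1's `bsdp_of_pPartOverC_baseChange`). Same final shape as
additive-p1's `bsdp_of_classX3M_of_forall_ramified` / `bsdp_of_classX4M_of_forall_ramified` for the
potentially multiplicative classes. Nothing in print supplies the over-`K` input (there `E_K` is
GOOD ORDINARY at the RAMIFIED prime above `p`, sibling file `GordDescentField.lean`); X4♯(G-ord)
stays CONSTRUCTION-SHAPED. [cite: HoffsteinLuo1997, Theorem (§1, pp. 435–436)]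
[cite: BurungaleCastellaSkinner2025, Cor. 1.3.1 (p. 4)] -/
theorem bsdp_of_classX4Gord_two_of_surj_of_forall_ramified
    (hGZK : rank_eq_analyticRank_of_analyticRank_le_one) (hmod : hasEntireLFunction_rat)
    (hMilneC : Milne1972.bsdQuotient_baseChange_quadratic_anyModel)
    (hBCS : BurungaleCastellaSkinner2025.cor131_padicValRat_bsd_rank_le_one)
    (hHL : HoffsteinLuo1997_exists_twist_L_one_ne_zero)
    (hp5 : 5 ≤ p) (hX : ClassX4Gord W p) (he : semistabilityIndex W p = 2) (hsurj : Surj W p)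
    (hr : W.analyticRank ≤ 1)
    (hK : ∀ (K : Type) [Field K] [NumberField K], Module.finrank ℚ K = 2 →
      (p : ℤ) ∣ NumberField.discr K → MissingPPartOverCAt (W.baseChange K) p) :
    BSDp W p := by
  have hp2 : p ≠ 2 := by omega
  obtain ⟨d', Wd, iWd, iWdm, hsq, hd8, hpd, ⟨C, hC⟩, hord, hr0⟩ :=
    exists_goodOrd_rankZero_twist_of_typeGOrd W p hHL hp5 hX.typeGOrd he
  obtain ⟨K, iF, iN, h2, hdK⟩ := exists_quadraticField_discr_pStar_mul p hp2 hsq hd8 hpd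
  have hdKQ : (NumberField.discr K : ℚ) = (-1 : ℚ) ^ (p / 2) * p * d' := by
    rw [hdK]; push_cast; ring
  have hpdK : (p : ℤ) ∣ NumberField.discr K := by
    rw [hdK]; exact ⟨(-1 : ℤ) ^ (p / 2) * d', by ring⟩
  have hd0 : ((-1 : ℚ) ^ (p / 2) * p * d') ≠ 0 :=
    mul_ne_zero (pStar_ne_zero p) (by exact_mod_cast hsq.ne_zero)
  have hrd : Wd.analyticRank ≤ 1 := by rw [hr0]; exact zero_le_one
  have hbsd : BSDp Wd p := RowC2.bsdp hBCS hGZK hrd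
    (rowC2_twist_of_classX4_of_surj W p Wd hp5 hX.classX4 hsurj hd0 ⟨C, hC⟩ hord)
  have hWdK : ∃ C : VariableChange ℚ, C • W.quadraticTwist (NumberField.discr K : ℚ) = Wd := by
    rw [hdKQ]; exact ⟨C, hC⟩
  exact bsdp_of_pPartOverC_baseChange W p K Wd hGZK hmod hMilneC hr h2 hWdK hrd (hK K h2 hpdK) hbsd

/-- The same with the plainer hypothesis "the `p`-part of BSD for `E` over EVERY quadratic field"
(twin of additive-p1's `bsdp_of_classX3M_of_forall_quadratic`).
[cite: HoffsteinLuo1997, Theorem (§1, pp. 435–436)] [cite: BurungaleCastellaSkinner2025, Cor. 1.3.1 (p. 4)] -/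
theorem bsdp_of_classX4Gord_two_of_surj_of_forall_quadratic
    (hGZK : rank_eq_analyticRank_of_analyticRank_le_one) (hmod : hasEntireLFunction_rat)
    (hMilneC : Milne1972.bsdQuotient_baseChange_quadratic_anyModel)
    (hBCS : BurungaleCastellaSkinner2025.cor131_padicValRat_bsd_rank_le_one)
    (hHL : HoffsteinLuo1997_exists_twist_L_one_ne_zero)
    (hp5 : 5 ≤ p) (hX : ClassX4Gord W p) (he : semistabilityIndex W p = 2) (hsurj : Surj W p)
    (hr : W.analyticRank ≤ 1)
    (hK : ∀ (K : Type) [Field K] [NumberField K], Module.finrank ℚ K = 2 →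
      MissingPPartOverCAt (W.baseChange K) p) :
    BSDp W p :=
  bsdp_of_classX4Gord_two_of_surj_of_forall_ramified W p hGZK hmod hMilneC hBCS hHL hp5 hX he hsurj hr
    (fun K _ _ h2 _ => hK K h2)

/-- The same in the cell's `MissingPPartAt` / `Gord.MissingInputAt` currency (Partition row):
`MissingPPartAt W p` from the over-`K` inputs over the quadratic fields ramified at `p`.
[cite: HoffsteinLuo1997, Theorem (§1, pp. 435–436)] [cite: BurungaleCastellaSkinner2025, Cor. 1.3.1 (p. 4)] -/
theorem missingPPartAt_of_classX4Gord_two_of_surj_of_forall_ramified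
    (hGZK : rank_eq_analyticRank_of_analyticRank_le_one) (hmod : hasEntireLFunction_rat)
    (hMilneC : Milne1972.bsdQuotient_baseChange_quadratic_anyModel)
    (hBCS : BurungaleCastellaSkinner2025.cor131_padicValRat_bsd_rank_le_one)
    (hHL : HoffsteinLuo1997_exists_twist_L_one_ne_zero)
    (hp5 : 5 ≤ p) (hX : ClassX4Gord W p) (he : semistabilityIndex W p = 2) (hsurj : Surj W p)
    (hr : W.analyticRank ≤ 1)
    (hK : ∀ (K : Type) [Field K] [NumberField K], Module.finrank ℚ K = 2 →
      (p : ℤ) ∣ NumberField.discr K → MissingPPartOverCAt (W.baseChange K) p) :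
    MissingPPartAt W p := by
  haveI : Finite W.sha := (hGZK W hr).2
  exact missingPPartAt_of_bsdp W p
    (bsdp_of_classX4Gord_two_of_surj_of_forall_ramified W p hGZK hmod hMilneC hBCS hHL hp5 hX he
      hsurj hr hK)

/-- **Exactness survives**: for EACH quadratic `K` with `p ∣ d_K` whose twist `E^{(d_K)}` is good
ordinary at `p` of analytic rank `≤ 1` (e.g. the supplied `K = ℚ(√(p*·d'))`), `BSD(E,p)` is
EQUIVALENT to the over-`K` input (gen 4's `bsdp_iff_overC_of_classX4Gord_two_of_surj` for
`d_K = p*`; here for any such `K`): the relocation loses nothing.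
[cite: BurungaleCastellaSkinner2025, Cor. 1.3.1 (p. 4)] -/
theorem bsdp_iff_overC_of_classX4_of_surj_of_goodOrd_twist
    (hGZK : rank_eq_analyticRank_of_analyticRank_le_one) (hmod : hasEntireLFunction_rat)
    (hMilneC : Milne1972.bsdQuotient_baseChange_quadratic_anyModel)
    (hBCS : BurungaleCastellaSkinner2025.cor131_padicValRat_bsd_rank_le_one)
    (hp5 : 5 ≤ p) (hX : ClassX4 W p) (hsurj : Surj W p) (hr : W.analyticRank ≤ 1)
    (K : Type) [Field K] [NumberField K] (h2 : Module.finrank ℚ K = 2)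
    (hWd : ∃ C : VariableChange ℚ, C • W.quadraticTwist (NumberField.discr K : ℚ) = Wd)
    (hord : GoodOrd Wd p) (hrd : Wd.analyticRank ≤ 1) :
    BSDp W p ↔ MissingPPartOverCAt (W.baseChange K) p := by
  have hd0 : (NumberField.discr K : ℚ) ≠ 0 := by exact_mod_cast NumberField.discr_ne_zero K
  have hbsd : BSDp Wd p := RowC2.bsdp hBCS hGZK hrd
    (rowC2_twist_of_classX4_of_surj W p Wd hp5 hX hsurj hd0 hWd hord)
  exact (missingPPartOverCAt_baseChange_iff_bsdp W p K Wd hGZK hmod hMilneC hr h2 hWd hrd hbsd).symm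

/-- **Existence of an EXACT descent field for every X4♯(G-ord) ∩ `I₀*` pair with `ρ̄` onto**
(`p ≥ 5`, `r_an(E) ≤ 1`; Hoffstein–Luo): there is a quadratic field `K` with `p ∣ d_K` such that
`BSD(E,p) ⟺ MissingPPartOverCAt (W.baseChange K) p` — twin of additive-p1's
`ClassX4M.exists_quadraticField_bsdp_iff_of_ram`. [cite: HoffsteinLuo1997, Theorem (§1, pp. 435–436)]
[cite: BurungaleCastellaSkinner2025, Cor. 1.3.1 (p. 4)] -/
theorem ClassX4Gord.exists_quadraticField_bsdp_iff
    (hGZK : rank_eq_analyticRank_of_analyticRank_le_one) (hmod : hasEntireLFunction_rat)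
    (hMilneC : Milne1972.bsdQuotient_baseChange_quadratic_anyModel)
    (hBCS : BurungaleCastellaSkinner2025.cor131_padicValRat_bsd_rank_le_one)
    (hHL : HoffsteinLuo1997_exists_twist_L_one_ne_zero)
    (hp5 : 5 ≤ p) (hX : ClassX4Gord W p) (he : semistabilityIndex W p = 2) (hsurj : Surj W p)
    (hr : W.analyticRank ≤ 1) :
    ∃ (K : Type) (_ : Field K) (_ : NumberField K), Module.finrank ℚ K = 2 ∧
      (p : ℤ) ∣ NumberField.discr K ∧ (BSDp W p ↔ MissingPPartOverCAt (W.baseChange K) p) := by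
  have hp2 : p ≠ 2 := by omega
  obtain ⟨d', Wd, iWd, iWdm, hsq, hd8, hpd, ⟨C, hC⟩, hord, hr0⟩ :=
    exists_goodOrd_rankZero_twist_of_typeGOrd W p hHL hp5 hX.typeGOrd he
  obtain ⟨K, iF, iN, h2, hdK⟩ := exists_quadraticField_discr_pStar_mul p hp2 hsq hd8 hpd
  have hdKQ : (NumberField.discr K : ℚ) = (-1 : ℚ) ^ (p / 2) * p * d' := by
    rw [hdK]; push_cast; ring
  have hpdK : (p : ℤ) ∣ NumberField.discr K := by
    rw [hdK]; exact ⟨(-1 : ℤ) ^ (p / 2) * d', by ring⟩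
  have hWdK : ∃ C : VariableChange ℚ, C • W.quadraticTwist (NumberField.discr K : ℚ) = Wd := by
    rw [hdKQ]; exact ⟨C, hC⟩
  have hrd : Wd.analyticRank ≤ 1 := by rw [hr0]; exact zero_le_one
  exact ⟨K, iF, iN, h2, hpdK, bsdp_iff_overC_of_classX4_of_surj_of_goodOrd_twist W p Wd hGZK hmod
    hMilneC hBCS hp5 hX.classX4 hsurj hr K h2 hWdK hord hrd⟩

end X4

end Summit.BirchSwinnertonDyer.Rank1Residual.Additive

end
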